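import Mathlib
import Summits.KontsevichZagierPeriods.KontsevichZagierPeriods.Theses.IsogenyCertificates

/-!
# Sketch — crux-ideate round 1, ideator 3, crux `IsogenyCertificates.XMapPeriodTransfer`
(stmt-KontsevichZagierPeriods-10665)

First-lemma signatures for two idea cards:

* card `saturated-sign-cells`: `WZerosSimple`, `noPole_of_W_ne`, `CellImageBounded`,
  `CellImageUnbounded`, `isSemialgebraic_basicCell`, `ValueFreeTransfer` (transfer form C⁺),
  `PeriodPos`, `Reduction₁`;
* card `double-first-descent`: `duplication_descent_identity` (proved, `ring`),
  `duplication_ge_root` (proved), `DuplicationIsDatum` (the `[2]` certificate identity for symbolic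
  `A B`, PROVED: `duplication_wronskian`, `duplication_wronskian_ne_zero`, `duplication_isDatum`,
  `duplicationIsDatum_holds`),
  `PushToIdentityComponent`, `PushSourceToTargetIdentityComponent`, `Reduction₂`.

Everything is stated over Mathlib + the summit's KZ calculus + the route decl; nothing here is a
proof of the crux.
-/

open Polynomial Set
open Literature.NumberTheory.Transcendental

namespace Summit.KontsevichZagierPeriods.KontsevichZagierPeriods.Cruxes.XMapPeriodTransfer.Ideas

/-- The x-rational isogeny datum of the crux, verbatim (Wronskian `W = f'g − fg'`). -/
def IsXDatum (A B A' B' : ℤ) (f g : ℚ[X]) (c : ℚ) : Prop :=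
  derivative f * g - f * derivative g ≠ 0 ∧
  C (c ^ 2) * g * (f ^ 3 + C (A' : ℚ) * f * g ^ 2 + C (B' : ℚ) * g ^ 3) =
    (X ^ 3 + C (A : ℚ) * X + C (B : ℚ)) * (derivative f * g - f * derivative g) ^ 2

/-- The real x-map `R = f/g` of a datum. -/
noncomputable def xmap (f g : ℚ[X]) (x : ℝ) : ℝ := aeval x f / aeval x g

/-- Real evaluation of the Wronskian. -/
noncomputable def wr (f g : ℚ[X]) (x : ℝ) : ℝ := aeval x (derivative f * g - f * derivative g)

/-! ## Card 1 — saturated sign cells -/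

/-- (Z) Inside `{P > 0}` every real zero of the Wronskian of a COPRIME datum is simple
(order-of-vanishing count in the datum identity: at a critical point `ord R' = 1`, at a pole
`ord g = 2`, `ord W = 1`). -/
def WZerosSimple : Prop :=
  ∀ (A B A' B' : ℤ) (f g : ℚ[X]) (c : ℚ), 4 * A ^ 3 + 27 * B ^ 2 ≠ 0 → 4 * A' ^ 3 + 27 * B' ^ 2 ≠ 0 →
    IsXDatum A B A' B' f g c → IsCoprime f g →
    ∀ x : ℝ, 0 < x ^ 3 + A * x + B → wr f g x = 0 →
      aeval x (derivative (derivative f * g - f * derivative g)) ≠ 0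

/-- Poles hide among the zeros of `W`: if `g x = 0` and `P x > 0` then `W x = 0` (evaluate the
datum identity at `x`; no coprimality needed). Hence `g ≠ 0` on every cell `{P > 0, W ≠ 0}`. -/
theorem noPole_of_W_ne (A B A' B' : ℤ) (f g : ℚ[X]) (c : ℚ) (h : IsXDatum A B A' B' f g c)
    (x : ℝ) (hP : 0 < x ^ 3 + A * x + B) (hW : wr f g x ≠ 0) : aeval x g ≠ 0 := by
  intro hg
  have hid := congrArg (fun p : ℚ[X] => aeval x p) h.2
  simp only [map_mul, map_add, map_pow, aeval_C, aeval_X, hg, eq_ratCast, Rat.cast_intCast,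
    mul_zero, zero_mul] at hid
  have hx : (x ^ 3 + (A : ℝ) * x + B) * (wr f g x) ^ 2 ≠ 0 := by
    have := pow_ne_zero 2 hW
    positivity
  exact hx (by simpa [wr] using hid.symm)

/-- (S, bounded cell) **Saturation.** For a coprime datum and a maximal cell `(p, q)` of
`{P > 0} ∖ {W = 0}` (i.e. `P > 0`, `W ≠ 0` inside, `P·W = 0` at both ends), `R = f/g` is injective
on the cell, maps it into `{P' > 0}`, and its image is an open interval whose ends are roots of
`P'` or `+∞` — hence a whole connected component of `{P' > 0}`. -/
def CellImageBounded : Prop :=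
  ∀ (A B A' B' : ℤ) (f g : ℚ[X]) (c : ℚ), 4 * A ^ 3 + 27 * B ^ 2 ≠ 0 → 4 * A' ^ 3 + 27 * B' ^ 2 ≠ 0 →
    IsXDatum A B A' B' f g c → IsCoprime f g →
    ∀ p q : ℝ, p < q →
      (∀ x ∈ Ioo p q, 0 < x ^ 3 + A * x + B ∧ wr f g x ≠ 0) →
      (p ^ 3 + A * p + B) * wr f g p = 0 → (q ^ 3 + A * q + B) * wr f g q = 0 →
      InjOn (xmap f g) (Ioo p q) ∧ xmap f g '' Ioo p q ⊆ {y | 0 < y ^ 3 + A' * y + B'} ∧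
      ∃ u : ℝ, u ^ 3 + A' * u + B' = 0 ∧
        (xmap f g '' Ioo p q = Ioi u ∨ ∃ v : ℝ, v ^ 3 + A' * v + B' = 0 ∧ xmap f g '' Ioo p q = Ioo u v)

/-- (S, unbounded cell) The same for the last cell `(p, ∞)` of the unbounded component. -/
def CellImageUnbounded : Prop :=
  ∀ (A B A' B' : ℤ) (f g : ℚ[X]) (c : ℚ), 4 * A ^ 3 + 27 * B ^ 2 ≠ 0 → 4 * A' ^ 3 + 27 * B' ^ 2 ≠ 0 →
    IsXDatum A B A' B' f g c → IsCoprime f g →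
    ∀ p : ℝ, (∀ x ∈ Ioi p, 0 < x ^ 3 + A * x + B ∧ wr f g x ≠ 0) →
      (p ^ 3 + A * p + B) * wr f g p = 0 →
      InjOn (xmap f g) (Ioi p) ∧ xmap f g '' Ioi p ⊆ {y | 0 < y ^ 3 + A' * y + B'} ∧
      ∃ u : ℝ, u ^ 3 + A' * u + B' = 0 ∧
        (xmap f g '' Ioi p = Ioi u ∨ ∃ v : ℝ, v ^ 3 + A' * v + B' = 0 ∧ xmap f g '' Ioi p = Ioo u v)

/-- (B) Cells are BASIC `ℚ`-semialgebraic: `{P > 0} ∩ {εW > 0} ∩ (s, s')` with RATIONAL `s, s'`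
needs no Thom lemma / quantifier elimination — polynomial sign conditions over `ℚ` only. -/
theorem isSemialgebraic_basicCell (P₁ P₂ : MvPolynomial (Fin 1) ℚ) (s s' : ℚ) :
    Literature.ModelTheory.ExponentialFields.IsSemialgebraic ℚ
      ({x : Fin 1 → ℝ | 0 < MvPolynomial.aeval x P₁} ∩ {x | 0 < MvPolynomial.aeval x P₂} ∩
        ({x | 0 < MvPolynomial.aeval x (MvPolynomial.X 0 - MvPolynomial.C s)} ∩
         {x | 0 < MvPolynomial.aeval x (MvPolynomial.C s' - MvPolynomial.X 0)})) :=
  ((Literature.ModelTheory.ExponentialFields.isSemialgebraic_setOf_eval_pos P₁).inter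
    (Literature.ModelTheory.ExponentialFields.isSemialgebraic_setOf_eval_pos P₂)).inter
    ((Literature.ModelTheory.ExponentialFields.isSemialgebraic_setOf_eval_pos _).inter
      (Literature.ModelTheory.ExponentialFields.isSemialgebraic_setOf_eval_pos _))

/-- (C⁺) **Value-free transfer** — the TRANSFER form of the crux: for every datum there is an
explicit positive rational ratio `ρ` (= #cells / (κ'·|c|), κ' = #components of `{P' > 0}`) with
`[{P>0}, a/√P] ~ [{P'>0}, ρa/√P']` for ALL `a > 0`; no hypothesis on values. -/
def ValueFreeTransfer : Prop :=
  ∀ (A B A' B' : ℤ), 4 * A ^ 3 + 27 * B ^ 2 ≠ 0 → 4 * A' ^ 3 + 27 * B' ^ 2 ≠ 0 →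
    ∀ (f g : ℚ[X]) (c : ℚ), IsXDatum A B A' B' f g c →
    ∃ ρ : ℚ, 0 < ρ ∧ ∀ (a : ℚ), 0 < a → ∀ (r r'' : KZ.IntegralRep 1),
      r.domain = {x | 0 < x 0 ^ 3 + (A : ℝ) * x 0 + (B : ℝ)} →
      EqOn r.integrand (fun x => (a : ℝ) / Real.sqrt (x 0 ^ 3 + (A : ℝ) * x 0 + (B : ℝ))) r.domain →
      r''.domain = {x | 0 < x 0 ^ 3 + (A' : ℝ) * x 0 + (B' : ℝ)} →
      EqOn r''.integrand (fun x => ((ρ * a : ℚ) : ℝ) / Real.sqrt (x 0 ^ 3 + (A' : ℝ) * x 0 + (B' : ℝ)))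
        r''.domain →
      KZ.Equivalent r r''

/-- The only analytic fact about values the line uses: a real period is positive. -/
def PeriodPos : Prop :=
  ∀ (A B : ℤ), 4 * A ^ 3 + 27 * B ^ 2 ≠ 0 → ∀ (b : ℚ), 0 < b → ∀ r : KZ.IntegralRep 1,
    r.domain = {x | 0 < x 0 ^ 3 + (A : ℝ) * x 0 + (B : ℝ)} →
    EqOn r.integrand (fun x => (b : ℝ) / Real.sqrt (x 0 ^ 3 + (A : ℝ) * x 0 + (B : ℝ))) r.domain →
    0 < r.value

/-- Shape of the composition for card 1: C⁺ and positivity give the crux BY NAME (value equality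
pins `b = ρa`; same domain + `EqOn` integrands is one identity change of variables,
`KZ.of_sub_of_mem_relations_of_null`). -/
def Reduction₁ : Prop :=
  ValueFreeTransfer → PeriodPos →
    Summit.KontsevichZagierPeriods.KontsevichZagierPeriods.Theses.IsogenyCertificates.XMapPeriodTransfer

/-! ## Card 2 — double first: the duplication datum as the egg → identity-component mover -/

/-- **2-descent square identity** for `y² = x³ + Ax + B`: with `f₂ = x⁴ − 2Ax² − 8Bx + A²`,
`g₂ = 4(x³ + Ax + B)` (x-map of `[2]`), for EVERY `e`,
`f₂ − e·g₂ = (x² − 2ex − 2e² − A)² − 4(2x + e)·(e³ + Ae + B)`; so at a root `e` of the cubic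
`x(2Q) − e` is a square over `4P(x)` (Cassels LMSST 24 §15, Lemmas 1–2). -/
theorem duplication_descent_identity {R : Type*} [CommRing R] (A B e x : R) :
    (x ^ 4 - 2 * A * x ^ 2 - 8 * B * x + A ^ 2) - e * (4 * (x ^ 3 + A * x + B)) =
      (x ^ 2 - 2 * e * x - 2 * e ^ 2 - A) ^ 2 - 4 * (2 * x + e) * (e ^ 3 + A * e + B) := by
  ring

/-- Consequence: on `{P > 0}` the duplication x-map dominates every real root of `P`, i.e. `[2]`
pushes every cell of `{P > 0}` into the closure of the UNBOUNDED component `(e_max, ∞)`. -/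
theorem duplication_ge_root (A B e x : ℝ) (he : e ^ 3 + A * e + B = 0)
    (hx : 0 < x ^ 3 + A * x + B) :
    e ≤ (x ^ 4 - 2 * A * x ^ 2 - 8 * B * x + A ^ 2) / (4 * (x ^ 3 + A * x + B)) := by
  rw [le_div_iff₀ (by positivity)]
  have key := duplication_descent_identity A B e x
  rw [he, mul_zero, sub_zero] at key
  nlinarith [key, sq_nonneg (x ^ 2 - 2 * e * x - 2 * e ^ 2 - A)]

/-- The duplication map IS an x-rational isogeny datum from `(A, B)` to itself with `c = 2`
(`[2]^*(dx/y) = 2·dx/y`): an identity of degree 13 in `ℤ[A, B][X]`; PROVED below for symbolic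
`A B` (`duplicationIsDatum_holds`, via `duplication_wronskian` and `duplication_isDatum`). -/
def DuplicationIsDatum : Prop :=
  ∀ (A B : ℤ), IsXDatum A B A B
    (X ^ 4 - C (2 * (A : ℚ)) * X ^ 2 - C (8 * (B : ℚ)) * X + C ((A : ℚ) ^ 2))
    (C 4 * (X ^ 3 + C (A : ℚ) * X + C (B : ℚ))) 2

/-- Wronskian of the duplication datum: `W₂ = 4X⁶ + 20AX⁴ + 80BX³ − 20A²X² − 16ABX − (4A³ + 32B²)`
(= `ψ₄/y`, the 4-division factor). Proved: `derivative` simp set, then `Polynomial.funext` +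
`eval` + `ring`. -/
theorem duplication_wronskian (A B : ℚ) :
    derivative (X ^ 4 - C (2 * A) * X ^ 2 - C (8 * B) * X + C (A ^ 2)) * (C 4 * (X ^ 3 + C A * X + C B)) -
      (X ^ 4 - C (2 * A) * X ^ 2 - C (8 * B) * X + C (A ^ 2)) * derivative (C 4 * (X ^ 3 + C A * X + C B)) =
    C 4 * X ^ 6 + C (20 * A) * X ^ 4 + C (80 * B) * X ^ 3 - C (20 * A ^ 2) * X ^ 2 - C (16 * A * B) * X
      - C (4 * A ^ 3 + 32 * B ^ 2) := by
  simp only [derivative_sub, derivative_add, derivative_mul, derivative_X_pow, derivative_C,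
    derivative_X, Nat.cast_ofNat, Nat.add_one_sub_one, pow_one, zero_mul, zero_add,
    add_zero, mul_one]
  refine Polynomial.funext fun x => ?_
  simp only [eval_sub, eval_add, eval_mul, eval_pow, eval_C, eval_X]
  ring

/-- `W₂ ≠ 0` (its `X⁶`-coefficient is `4`). -/
theorem duplication_wronskian_ne_zero (A B : ℚ) :
    derivative (X ^ 4 - C (2 * A) * X ^ 2 - C (8 * B) * X + C (A ^ 2)) * (C 4 * (X ^ 3 + C A * X + C B)) -
      (X ^ 4 - C (2 * A) * X ^ 2 - C (8 * B) * X + C (A ^ 2)) * derivative (C 4 * (X ^ 3 + C A * X + C B)) ≠ 0 := by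
  rw [duplication_wronskian]
  intro h
  have := congrArg (fun p : ℚ[X] => p.coeff 6) h
  simp only [coeff_add, coeff_sub, coeff_C_mul, coeff_X_pow, coeff_C, coeff_X, coeff_zero] at this
  norm_num at this

/-- **The duplication map is a datum with `c = 2`**: the degree-13 certificate identity
`4·g₂·(f₂³ + A f₂ g₂² + B g₂³) = P·W₂²` for SYMBOLIC `A B`, machine-checked (`Polynomial.funext`,
`eval`, `ring`; 4 s). -/
theorem duplication_isDatum (A B : ℚ) :
    C ((2 : ℚ) ^ 2) * (C 4 * (X ^ 3 + C A * X + C B)) *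
      ((X ^ 4 - C (2 * A) * X ^ 2 - C (8 * B) * X + C (A ^ 2)) ^ 3 +
        C A * (X ^ 4 - C (2 * A) * X ^ 2 - C (8 * B) * X + C (A ^ 2)) * (C 4 * (X ^ 3 + C A * X + C B)) ^ 2 +
        C B * (C 4 * (X ^ 3 + C A * X + C B)) ^ 3) =
    (X ^ 3 + C A * X + C B) *
      (derivative (X ^ 4 - C (2 * A) * X ^ 2 - C (8 * B) * X + C (A ^ 2)) * (C 4 * (X ^ 3 + C A * X + C B)) -
        (X ^ 4 - C (2 * A) * X ^ 2 - C (8 * B) * X + C (A ^ 2)) * derivative (C 4 * (X ^ 3 + C A * X + C B))) ^ 2 := by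
  rw [duplication_wronskian]
  refine Polynomial.funext fun x => ?_
  simp only [eval_sub, eval_add, eval_mul, eval_pow, eval_C, eval_X]
  ring

/-- `DuplicationIsDatum` HOLDS for all integral `(A, B)` (no nonsingularity needed). -/
theorem duplicationIsDatum_holds : DuplicationIsDatum := fun A B =>
  ⟨duplication_wronskian_ne_zero (A : ℚ) (B : ℚ), duplication_isDatum (A : ℚ) (B : ℚ)⟩

/-- **Push to the identity component.** For every nonsingular `(A, B)` there is `q ∈ {1, 2}`
(the number of components of `{P > 0}`) with `[{P > 0}, a/√P] ~ [U, q·a/√P]`,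
`U = (e_max, ∞) = {x | ∀ y ≥ x, P y > 0}`, realised by the cells of the DUPLICATION datum
(all maps in `ℚ(x)`: no Möbius 2-torsion translation with coefficients in `ℚ(e₁,e₂,e₃)`). -/
def PushToIdentityComponent : Prop :=
  ∀ (A B : ℤ), 4 * A ^ 3 + 27 * B ^ 2 ≠ 0 → ∃ q : ℚ, (q = 1 ∨ q = 2) ∧
    ∀ (a : ℚ), 0 < a → ∀ (r u : KZ.IntegralRep 1),
      r.domain = {x | 0 < x 0 ^ 3 + (A : ℝ) * x 0 + (B : ℝ)} →
      EqOn r.integrand (fun x => (a : ℝ) / Real.sqrt (x 0 ^ 3 + (A : ℝ) * x 0 + (B : ℝ))) r.domain →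
      u.domain = {x | ∀ y : ℝ, x 0 ≤ y → 0 < y ^ 3 + (A : ℝ) * y + (B : ℝ)} →
      EqOn u.integrand (fun x => ((q * a : ℚ) : ℝ) / Real.sqrt (x 0 ^ 3 + (A : ℝ) * x 0 + (B : ℝ)))
        u.domain →
      KZ.Equivalent r u

/-- Per-datum push of the SOURCE period to the TARGET identity component: cells of the datum
followed by cells of `[2]` on the target (or, equivalently, cells of the composite datum
`[2] ∘ R`, multiplier `2c`), every image being `U'` by `duplication_ge_root`. -/
def PushSourceToTargetIdentityComponent : Prop :=
  ∀ (A B A' B' : ℤ), 4 * A ^ 3 + 27 * B ^ 2 ≠ 0 → 4 * A' ^ 3 + 27 * B' ^ 2 ≠ 0 →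
    ∀ (f g : ℚ[X]) (c : ℚ), IsXDatum A B A' B' f g c →
    ∃ m : ℕ, 0 < m ∧ ∀ (a : ℚ), 0 < a → ∀ (r u : KZ.IntegralRep 1),
      r.domain = {x | 0 < x 0 ^ 3 + (A : ℝ) * x 0 + (B : ℝ)} →
      EqOn r.integrand (fun x => (a : ℝ) / Real.sqrt (x 0 ^ 3 + (A : ℝ) * x 0 + (B : ℝ))) r.domain →
      u.domain = {x | ∀ y : ℝ, x 0 ≤ y → 0 < y ^ 3 + (A' : ℝ) * y + (B' : ℝ)} →
      EqOn u.integrand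
        (fun x => ((m * a / (2 * |c|) : ℚ) : ℝ) / Real.sqrt (x 0 ^ 3 + (A' : ℝ) * x 0 + (B' : ℝ)))
        u.domain →
      KZ.Equivalent r u

/-- Shape of the composition for card 2: both `r` and `r'` are pushed to the SAME interval `U'`
with rational-map moves; value equality and `PeriodPos` (for `U'`) match the two scalars;
transitivity/symmetry of `KZ.Equivalent` concludes the crux BY NAME. -/
def Reduction₂ : Prop :=
  PushSourceToTargetIdentityComponent → PushToIdentityComponent → PeriodPos →
    Summit.KontsevichZagierPeriods.KontsevichZagierPeriods.Theses.IsogenyCertificates.XMapPeriodTransfer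

/-! ## Calibration: the lemniscate datum is a datum (as in the route file) -/

example : IsXDatum (-1) 0 4 0 (X ^ 2 - 1) X 1 := by
  refine ⟨?_, ?_⟩
  · have hw : derivative (X ^ 2 - 1 : ℚ[X]) * X - (X ^ 2 - 1) * derivative X = X ^ 2 + 1 := by
      simp only [derivative_sub, derivative_X_pow, derivative_one, derivative_X, Nat.cast_ofNat,
        map_ofNat, Nat.add_one_sub_one, pow_one]
      ring
    rw [hw]; intro h0
    have := congrArg (fun p : ℚ[X] => p.coeff 0) h0
    simp at this
  · simp only [derivative_sub, derivative_X_pow, derivative_one, derivative_X, Nat.cast_ofNat,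
      Int.cast_ofNat, map_ofNat, Nat.add_one_sub_one, pow_one, Int.cast_neg, Int.cast_one,
      Int.cast_zero, map_neg, map_one, map_zero, one_pow]
    ring

end Summit.KontsevichZagierPeriods.KontsevichZagierPeriods.Cruxes.XMapPeriodTransfer.Ideas
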